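import Summits.KontsevichZagierPeriods.KontsevichZagierPeriods.Theorems.LiouvilleUnfoldingAyoubPiLocalKernelNilCut
import Mathlib.LinearAlgebra.Matrix.Adjugate

/-!
# Item stmt-KontsevichZagierPeriods-0541: unconditional instances of the `[π]`-local kernel shape
# from one-sided period pairings (Cramer's rule in the formal period ring)

Support file (`--supports` stmt-KontsevichZagierPeriods-0541), card `adjugate-transposition` of the crux
(ideator 2), recorded for the line `SketchIdeator2`.  `P := KZ.FormalPeriodRing`, `p :=
KZ.toFormalPeriod (KZ.of KZ.piRep)`.  The item says: every `x : P` of value `0` satisfies `p ^ N * x = 0`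
for some `N`.  A mechanism PRODUCING such pairs (value-`0` class, explicit exponent) unconditionally:

* `transpose_pairing` — in any commutative ring, a ONE-sided matrix identity `A * B = w • 1` forces the
  transposed one `w`-locally with the explicit exponent `card n`: `w ^ n • (B * A - w • 1) = 0`
  (`(BA - w) B = 0`, multiply by `adjugate B`, then use `det A * det B = w ^ n`).  The power of `w` cannot
  be dropped in general (`transpose_pairing_needs_w`: `A = E₁₂`, `B = E₁₁`, `w = 0` in `M₂(ℤ)`).
* `transposedPairing_piTorsion` — hence for square matrices of formal periods with a certified pairing
  `A * B = p ^ m • 1` (the compiled form of a perfect duality pairing whose determinant is a power of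
  `π`: Legendre / Riemann period relations), every entry `x` of `B * A - p ^ m • 1` has value `0` AND is
  killed by `p ^ (m * card n)` — it satisfies hypothesis and conclusion of item 0541 with an explicit
  exponent, while `x = 0` itself would need `π`-cancellation (item 0540).
* `annihilator_piLocal` — certified column relations `A * C = 0` of such an `A` are `p`-locally trivial.

References: J. Ayoub, EMS Newsl. 91 (2014), Conj. 7; M. Kontsevich, D. Zagier, *Periods* (2001), §4.1.
Mathlib: `Matrix.mul_adjugate`, `Matrix.det_mul`, `Matrix.det_smul`.  No definition is introduced.
-/

noncomputable section

open Literature.NumberTheory.Transcendental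

namespace Summit.KontsevichZagierPeriods.LiouvilleUnfolding.NilradicalCut

open Summit.KontsevichZagierPeriods.LiouvilleUnfolding.PiLocalKernelPosition

section Algebra

variable {R : Type*} [CommRing R] {n : Type*} [Fintype n] [DecidableEq n]

/-- **One-sided pairing ⟹ `w`-local two-sided pairing (Cramer).** If `A * B = w • 1` then
`w ^ card n • (B * A - w • 1) = 0`. [folklore] -/
theorem transpose_pairing (A B : Matrix n n R) (w : R) (h : A * B = w • (1 : Matrix n n R)) :
    w ^ Fintype.card n • (B * A - w • (1 : Matrix n n R)) = 0 := by
  have h1 : (B * A - w • (1 : Matrix n n R)) * B = 0 := by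
    rw [sub_mul, Matrix.mul_assoc, h, Matrix.mul_smul, Matrix.mul_one, Matrix.smul_mul, Matrix.one_mul,
      sub_self]
  have h2 : (B * A - w • (1 : Matrix n n R)) * (B * B.adjugate) = 0 := by
    rw [← Matrix.mul_assoc, h1, Matrix.zero_mul]
  rw [Matrix.mul_adjugate, Matrix.mul_smul, Matrix.mul_one] at h2
  have hdet : A.det * B.det = w ^ Fintype.card n := by
    rw [← Matrix.det_mul, h, Matrix.det_smul, Matrix.det_one, mul_one]
  rw [← hdet, mul_smul, h2, smul_zero]

/-- **Saturation transfer.** If `d ≡ u * w ^ m` modulo an ideal `I` with `u` a unit, then every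
`d`-saturated consequence of `I` is a `w`-local one with exponent `m * N`. [folklore] -/
theorem sat_transfer {I : Ideal R} {d w u : R} (hu : IsUnit u) {m : ℕ} (hd : d - u * w ^ m ∈ I)
    {x : R} {N : ℕ} (hx : d ^ N * x ∈ I) : w ^ (m * N) * x ∈ I := by
  rw [← Ideal.Quotient.eq_zero_iff_mem] at hx ⊢
  have hd' : Ideal.Quotient.mk I d = Ideal.Quotient.mk I (u * w ^ m) := by
    rw [Ideal.Quotient.eq]; exact hd
  rw [map_mul, map_pow, hd', ← map_pow, ← map_mul, Ideal.Quotient.eq_zero_iff_mem] at hx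
  have : (u * w ^ m) ^ N * x = u ^ N * (w ^ (m * N) * x) := by ring
  rw [this, ← Ideal.Quotient.eq_zero_iff_mem, map_mul] at hx
  exact ((hu.pow N).map _).mul_right_eq_zero.mp hx

end Algebra

/-- **The power of `w` cannot be dropped** in `transpose_pairing`: in `M₂(ℤ)`, `A = E₁₂`, `B = E₁₁`,
`w = 0` give `A * B = w • 1` but `B * A ≠ w • 1`. [folklore] -/
theorem transpose_pairing_needs_w :
    ∃ (A B : Matrix (Fin 2) (Fin 2) ℤ) (w : ℤ), A * B = w • (1 : Matrix (Fin 2) (Fin 2) ℤ) ∧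
      B * A ≠ w • (1 : Matrix (Fin 2) (Fin 2) ℤ) := by
  refine ⟨Matrix.of ![![0, 1], ![0, 0]], Matrix.of ![![1, 0], ![0, 0]], 0, ?_, ?_⟩
  · ext i j
    fin_cases i <;> fin_cases j <;> simp [Matrix.mul_apply, Fin.sum_univ_two]
  · intro h
    have := congrFun (congrFun h 0) 1
    simp [Matrix.mul_apply, Fin.sum_univ_two] at this

variable {n : Type*} [Fintype n] [DecidableEq n]

/-- **Instances of item 0541's shape by certificate.** For square matrices `A`, `B` of formal periods
with `A * B = p ^ m • 1`, every entry of `B * A - p ^ m • 1` has value `0` and is killed by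
`p ^ (m * card n)`. [cite: Ayoub2014, Conj. 7] -/
theorem transposedPairing_instance (A B : Matrix n n KZ.FormalPeriodRing) (m : ℕ)
    (h : A * B = (KZ.toFormalPeriod (KZ.of KZ.piRep) ^ m) • (1 : Matrix n n KZ.FormalPeriodRing))
    (i j : n) :
    KZ.evalP ((B * A - (KZ.toFormalPeriod (KZ.of KZ.piRep) ^ m) •
        (1 : Matrix n n KZ.FormalPeriodRing)) i j) = 0 ∧
      KZ.toFormalPeriod (KZ.of KZ.piRep) ^ (m * Fintype.card n) *
        (B * A - (KZ.toFormalPeriod (KZ.of KZ.piRep) ^ m) • (1 : Matrix n n KZ.FormalPeriodRing)) i j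
          = 0 := by
  have key := transpose_pairing A B (KZ.toFormalPeriod (KZ.of KZ.piRep) ^ m) h
  have hij := congrFun (congrFun key i) j
  simp only [Matrix.smul_apply, Matrix.zero_apply, smul_eq_mul, ← pow_mul] at hij
  exact ⟨evalP_eq_zero_of_pow_mul_eq_zero hij, hij⟩

/-- **Certified column relations of a `π`-invertible period matrix are `π`-locally trivial**: if
`A * B = p ^ m • 1` and `A * C = 0` then `(p ^ m) ^ card n • (p ^ m • C) = 0`. [folklore] -/
theorem annihilator_piLocal (A B C : Matrix n n KZ.FormalPeriodRing) (m : ℕ)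
    (h : A * B = (KZ.toFormalPeriod (KZ.of KZ.piRep) ^ m) • (1 : Matrix n n KZ.FormalPeriodRing))
    (hC : A * C = 0) :
    (KZ.toFormalPeriod (KZ.of KZ.piRep) ^ m) ^ Fintype.card n •
      ((KZ.toFormalPeriod (KZ.of KZ.piRep) ^ m) • C) = 0 := by
  have key := transpose_pairing A B (KZ.toFormalPeriod (KZ.of KZ.piRep) ^ m) h
  have : (KZ.toFormalPeriod (KZ.of KZ.piRep) ^ m) ^ Fintype.card n •
      ((B * A - (KZ.toFormalPeriod (KZ.of KZ.piRep) ^ m) • (1 : Matrix n n KZ.FormalPeriodRing)) * C)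
        = 0 := by
    rw [← Matrix.smul_mul, key, Matrix.zero_mul]
  rwa [sub_mul, Matrix.mul_assoc, hC, Matrix.mul_zero, zero_sub, Matrix.smul_mul, Matrix.one_mul,
    smul_neg, neg_eq_zero] at this

/-- **Registered sub-goal of the line** (`transposedPairing_piTorsion`, `∀`-form): entries of transposed
certified pairings satisfy hypothesis and conclusion of item 0541 with exponent `m * card n`.
[cite: Ayoub2014, Conj. 7] -/
theorem transposedPairing_piTorsion : ∀ {n : Type} [Fintype n] [DecidableEq n] (A B : Matrix n n KZ.FormalPeriodRing) (m : ℕ), A * B = (KZ.toFormalPeriod (KZ.of KZ.piRep) ^ m) • (1 : Matrix n n KZ.FormalPeriodRing) → ∀ i j : n, KZ.evalP ((B * A - (KZ.toFormalPeriod (KZ.of KZ.piRep) ^ m) • (1 : Matrix n n KZ.FormalPeriodRing)) i j) = 0 ∧ KZ.toFormalPeriod (KZ.of KZ.piRep) ^ (m * Fintype.card n) * (B * A - (KZ.toFormalPeriod (KZ.of KZ.piRep) ^ m) • (1 : Matrix n n KZ.FormalPeriodRing)) i j = 0 :=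
  fun A B m h i j => transposedPairing_instance A B m h i j

end Summit.KontsevichZagierPeriods.LiouvilleUnfolding.NilradicalCut

end
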